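/-
Copyright: seat `ym-line-cbag-p2` (prover-ym-line-cbag-p2-g2-0), route `ColdBoxAllGroups`, crux `BulkAllGroups`
(stmt-QuantumFields-22255), line `dlr-chessboard-G` (skeleton `Cruxes/BulkAllGroups/Lines/birth.lean` v5).
-/
import Summits.QuantumFields.YangMills.Theorems.ColdBoxAllGroupsBulkAllGroupsDatumSplitG
import Summits.QuantumFields.YangMills.Theorems.ColdBoxAllGroupsBoxFloorAllGroupsRepresentationGBall
import Summits.QuantumFields.YangMills.Theorems.ColdBoxAllGroupsBulkAllGroupsLinkSmallDatumG
import Summits.QuantumFields.YangMills.Theorems.ColdBoxAllGroupsBulkAllGroupsKernelGoodEventG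
import Summits.QuantumFields.YangMills.Theorems.WeakCouplingRatesBulkDominatesColdBoxWForestGaugeDatum

/-!
# Crux `BulkAllGroups` (stmt-QuantumFields-22255), stubs `stub_kernelCovExpansionG` / `stub_kernelMeanExpansionG`: the REPRESENTATION of
# the small-field conditioned DLR box kernel with an exterior datum as a bounded tilt of the conditioned `D`-colour Dirichlet Gaussian (T3),
# every compact group presented in `U(N)`, exponential chart — part 1 (Steps 1–3); part 2 `…RepresentationDatumG` assembles T3

`G`-generic port of `Theorems/WeakCouplingRatesColdBoxRepresentationDatum.lean` (the `SU(2)` trunk theorem T3 of the ϑ-datum pass of the proved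
crux `BulkDominatesColdBoxW`: gnomonic chart, three colours), i.e. the ϑ-twin of the sibling crux's flat representation
`integral_cond_boxState_eq_integral_tilted_G` / `…_G'` (`Theorems/ColdBoxAllGroupsBoxFloorAllGroupsRepresentationG(Ball).lean`), in the datum
vocabulary of `Theorems/ColdBoxAllGroupsOneScaleDatumDefsG.lean` (`datVec`, `meanTE`, `chartCfgDE`, `cfgTDE`, `goodTDE`, `tiltWDE`; scale `√β`).

**`integral_cond_boxKernelG_eq_integral_tilted_datum`** (`'` = density positive on the chart ball only).  Let `ρ : G →* U(N)` be faithful,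
continuous and unitary, `β > 0`, `H ≥ 1`; let the exterior datum `W` have chart links `W e = ψ(ϑ_e)`, `ψ = expChart ρ`, `ϑ_e = datVec ϑ e`,
`‖ϑ_e‖ ≤ r` (`r ≥ 0`) for every `e` off the cold box `Λ = boxEdges 4 (2H+1)`; let `B = closedBall 0 m`, `m ≤ 1/4`, contain through `ψ` every
group element within the link window `‖ρ u − 1‖_F ≤ (12H²+2H+1)(√2·√(β^{2ε−1}) + 8r)` (`hball`: on the small-field event every gauge-fixed free
link IS that close to `1`, by w2's brick `frobDist_link_le_of_plaqCost_le_of_exterior_le`); let the Haar measure in the chart have density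
`c·g` on `B` (`hdens`, produced from Helgason's Jacobian by `…ChartDensityJ`); and let the good events be charged.  Then for every measurable
gauge-invariant `X ≥ 0`,
`∫ X d(γ_Λ(·|W)[|coldGoodSetG]) = ∫ X(cfgTDE ρ H β ϑ t) d(((gaussD H D)[|S]).tilted (𝟙_S·tiltWDE ρ H g β ϑ))(t)`,
`S = goodTDE ρ H β ε ϑ ∩ {t | ∀ e, ‖unscaleTE H D β (t + μ') e‖ ≤ m}` (`μ' = meanTE H D β ϑ` — the harmonic mean shift sits INSIDE `cfgTDE`;
the Gaussian reference stays the UNshifted `gaussD H D`).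
Chain = the flat chain with three substitutions: the datum forest gauge `integral_ymSpecification_box_eq_coldFree` (M1) for
`integral_boxState_eq_coldFree`; the Poincaré ladder with small exterior for R1, so that on the good event every free link is in `ψ(B)` and the
product chart `lintegral_pi_image_expChart` applies, the glued configuration being `chartCfgDE ρ ϑ w` (`glueWith_coldExt₁_expChart_datum`); and, on
the Gaussian side, the change of variables `w = unscaleTE (t + μ')` (constant Jacobian × a Lebesgue translation,
`exists_lintegral_eq_mul_lintegral_unscaleTE_add`) followed by the density identity with datum `exists_boltzmann_mul_density_datum_eq` and
`lintegral_mul_prod_gaussWeight_eq_D`.  All constants (`c^n`, `a`, `C`, `Z^D`) cancel (`integral_tilted_cond_eq_ratio`).  No hypothesis on the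
forest values of `ϑ` is needed here (they enter only the SIZE of the tilt, T4).
No sorry; no new definition; standard axioms.  NOT a claim about the mass gap: rung-level support (R2xi-G `XiPow`, RECORD label); the
Yang–Mills mass gap is NOT proved by any of this.
-/

set_option autoImplicit false
set_option synthInstance.maxSize 4096

noncomputable section

open MeasureTheory ProbabilityTheory Finset Metric
open scoped ENNReal Matrix.Norms.Frobenius
open Literature.Probability.LatticeModels (Site glueWith glueWith_apply_mem glueWith_apply_not_mem measurable_glueWith)
open Literature.MathematicalPhysics.QuantumLattice
open Literature.MathematicalPhysics.QuantumFieldTheory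
open Literature.MathematicalPhysics.QuantumFieldTheory.LatticeMaxwell
open Literature.MathematicalPhysics.QuantumFieldTheory.AxialGauge
open Literature.MathematicalPhysics.QuantumFieldTheory.GaussianToolkit

namespace Summit.QuantumFields.YangMills.Theorems.ColdBoxAllGroups

open Summit.QuantumFields.YangMills.Theorems.WeakCouplingRates
open Summit.QuantumFields.YangMills.Theorems.FreeEnergyLogCoefficient

variable {H : ℕ}

/-! ## The window event with datum is measurable -/

/-- The shifted ball condition on the chart coordinates is a measurable event. -/
theorem measurableSet_ball_unscaleTE_add (D : ℕ) (β m : ℝ) (μ : TSpaceD H D) :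
    MeasurableSet {t : TSpaceD H D | ∀ e, ‖unscaleTE H D β (t + μ) e‖ ≤ m} := by
  have h : {t : TSpaceD H D | ∀ e, ‖unscaleTE H D β (t + μ) e‖ ≤ m} = ⋂ e, {t | ‖unscaleTE H D β (t + μ) e‖ ≤ m} := by
    ext t; simp
  rw [h]
  exact MeasurableSet.iInter fun e =>
    measurableSet_le (((measurable_pi_apply e).comp ((measurable_unscaleTE D β).comp (measurable_add_const_TSpaceD D μ))).norm)
      measurable_const

/-! ## Step 1 (datum): conditional kernel expectations as ratios of free-link integrals -/

section Box

variable {N : ℕ} {G : Type} [Group G] [TopologicalSpace G] [IsTopologicalGroup G] [CompactSpace G]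
  [MeasurableSpace G] [BorelSpace G] [SecondCountableTopology G]
variable (ρ : G →* Matrix (Fin N) (Fin N) ℂ)

/-- The free-link integral with datum `N_W(𝟙_G X) = ∫ (𝟙_G X)(U_v^W) e^{−βS_Λ(U_v^W)} dσ^{free}(v)` of the temporal-forest gauge,
`U_v^W = glueWith Λ (coldExt₁ v) W`, expresses `∫ 𝟙_G X d(boxKernelG ρ β H W)` for gauge-invariant `X`. -/
theorem integral_boxKernelG_indicator_eq (hρc : Continuous ρ) (β ε : ℝ) (H : ℕ) (W : LGConfig 4 G) {X : LGConfig 4 G → ℝ}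
    (hXm : Measurable X) (hX : IsZdGaugeInvariant X) :
    ∫ U, (coldGoodSetG ρ H β ε).indicator X U ∂(boxKernelG ρ β H W) =
      (∫ v, (coldGoodSetG ρ H β ε).indicator X (glueWith (boxEdges 4 (2 * H + 1)) (coldExt₁ v) W) *
          Real.exp (-β * wilsonBoundaryAction ρ (boxEdges 4 (2 * H + 1)) (glueWith (boxEdges 4 (2 * H + 1)) (coldExt₁ v) W))
        ∂(Measure.pi fun _ : ColdFreeIdx H => haarProbability G)) /
      ∫ v, Real.exp (-β * wilsonBoundaryAction ρ (boxEdges 4 (2 * H + 1)) (glueWith (boxEdges 4 (2 * H + 1)) (coldExt₁ v) W))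
        ∂(Measure.pi fun _ : ColdFreeIdx H => haarProbability G) :=
  integral_ymSpecification_box_eq_coldFree ρ hρc β H W (hXm.indicator (measurableSet_coldGoodSetG ρ hρc β ε))
    (isZdGaugeInvariant_indicator_coldGoodSetG ρ β ε hX)

/-- **Step 1 (datum).**  `E_{γ(·|W)[|G]}[X] = N_W(𝟙_G X) / N_W(𝟙_G)` for measurable gauge-invariant `X` (`G = coldGoodSetG ρ H β ε` charged). -/
theorem integral_cond_boxKernelG_eq_ratio (hρc : Continuous ρ) (β ε : ℝ) (H : ℕ) (W : LGConfig 4 G)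
    (hG0 : boxKernelG ρ β H W (coldGoodSetG ρ H β ε) ≠ 0) {X : LGConfig 4 G → ℝ} (hXm : Measurable X) (hX : IsZdGaugeInvariant X) :
    ∫ U, X U ∂((boxKernelG ρ β H W)[|coldGoodSetG ρ H β ε]) =
      (∫ v, (coldGoodSetG ρ H β ε).indicator X (glueWith (boxEdges 4 (2 * H + 1)) (coldExt₁ v) W) *
          Real.exp (-β * wilsonBoundaryAction ρ (boxEdges 4 (2 * H + 1)) (glueWith (boxEdges 4 (2 * H + 1)) (coldExt₁ v) W))
        ∂(Measure.pi fun _ : ColdFreeIdx H => haarProbability G)) /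
      ∫ v, (coldGoodSetG ρ H β ε).indicator (fun _ => (1 : ℝ)) (glueWith (boxEdges 4 (2 * H + 1)) (coldExt₁ v) W) *
          Real.exp (-β * wilsonBoundaryAction ρ (boxEdges 4 (2 * H + 1)) (glueWith (boxEdges 4 (2 * H + 1)) (coldExt₁ v) W))
        ∂(Measure.pi fun _ : ColdFreeIdx H => haarProbability G) := by
  haveI : IsProbabilityMeasure (boxKernelG ρ β H W) := isProbabilityMeasure_boxKernelG ρ hρc β H W
  set μ := boxKernelG ρ β H W with hμ
  set Gd := coldGoodSetG ρ H β ε with hG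
  have hGm : MeasurableSet Gd := measurableSet_coldGoodSetG ρ hρc β ε
  have hnum : ∫ U in Gd, X U ∂μ = ∫ U, Gd.indicator X U ∂μ := (integral_indicator hGm).symm
  have hmass : μ.real Gd = ∫ U, Gd.indicator (fun _ => (1 : ℝ)) U ∂μ := by
    rw [integral_indicator hGm, setIntegral_const, smul_eq_mul, mul_one]
  rw [integral_cond_eq, hnum, hmass, hG, integral_boxKernelG_indicator_eq ρ hρc β ε H W hXm hX,
    integral_boxKernelG_indicator_eq ρ hρc β ε H W measurable_const (fun _ _ => rfl)]
  set A := ∫ v, (coldGoodSetG ρ H β ε).indicator X (glueWith (boxEdges 4 (2 * H + 1)) (coldExt₁ v) W) *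
      Real.exp (-β * wilsonBoundaryAction ρ (boxEdges 4 (2 * H + 1)) (glueWith (boxEdges 4 (2 * H + 1)) (coldExt₁ v) W))
    ∂(Measure.pi fun _ : ColdFreeIdx H => haarProbability G) with hA
  set B := ∫ v, (coldGoodSetG ρ H β ε).indicator (fun _ => (1 : ℝ)) (glueWith (boxEdges 4 (2 * H + 1)) (coldExt₁ v) W) *
      Real.exp (-β * wilsonBoundaryAction ρ (boxEdges 4 (2 * H + 1)) (glueWith (boxEdges 4 (2 * H + 1)) (coldExt₁ v) W))
    ∂(Measure.pi fun _ : ColdFreeIdx H => haarProbability G) with hB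
  set Z := ∫ v, Real.exp (-β * wilsonBoundaryAction ρ (boxEdges 4 (2 * H + 1)) (glueWith (boxEdges 4 (2 * H + 1)) (coldExt₁ v) W))
    ∂(Measure.pi fun _ : ColdFreeIdx H => haarProbability G) with hZ
  have hBZ : B / Z = μ.real Gd := by
    rw [hmass, hG, integral_boxKernelG_indicator_eq ρ hρc β ε H W measurable_const (fun _ _ => rfl)]
  have hreal : μ.real Gd ≠ 0 := by
    rw [measureReal_def]; exact ENNReal.toReal_ne_zero.2 ⟨hG0, measure_ne_top _ _⟩
  have hB0 : B ≠ 0 := fun h => hreal (by rw [← hBZ, h, zero_div])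
  have hZ0 : Z ≠ 0 := fun h => hreal (by rw [← hBZ, h, div_zero])
  field_simp

/-! ## Step 2 (datum): the free-link integrals in the product exponential chart -/

omit [IsTopologicalGroup G] [MeasurableSpace G] [BorelSpace G] [SecondCountableTopology G] in
/-- **On the small-field event, with a small exterior datum, every free link of the glued configuration lies in the chart image `ψ(B)`**
(w2's brick `frobDist_link_le_of_plaqCost_le_of_exterior_le`: `‖ρ(V_e) − 1‖_F ≤ (12H²+2H+1)(√2·√(β^{2ε−1}) + 8r)`, and the
local-surjectivity hypothesis `hball`). -/
theorem mem_image_expChart_of_mem_coldGoodSetG_datum (hρc : Continuous ρ) (hinj : Function.Injective ρ)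
    (hρu : ∀ g, ρ g ∈ Matrix.unitaryGroup (Fin N) ℂ) {β ε r : ℝ} (hβ : 0 < β) (hH : 1 ≤ H) (hr : 0 ≤ r)
    {B : Set (EuclideanSpace ℝ (Fin (dimE ρ)))}
    (hball : ∀ u : G, ‖ρ u - 1‖ ≤ (12 * (H : ℝ) ^ 2 + 2 * H + 1) * (Real.sqrt 2 * Real.sqrt (β ^ (2 * ε - 1)) + 8 * r) →
      u ∈ expChart ρ '' B)
    {W : LGConfig 4 G} {ϑ : Fin (dimE ρ) → (Literature.MathematicalPhysics.QuantumLattice.ZdEdge 4 → ℝ)}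
    (hW : ∀ e, e ∉ boxEdges 4 (2 * H + 1) → W e = expChart ρ (datVec ϑ e))
    (hϑ : ∀ e, e ∉ boxEdges 4 (2 * H + 1) → ‖datVec ϑ e‖ ≤ r)
    (v : ColdFreeCfg (G := G) H) (hv : glueWith (boxEdges 4 (2 * H + 1)) (coldExt₁ v) W ∈ coldGoodSetG ρ H β ε) (e : ColdFreeIdx H) :
    v e ∈ expChart ρ '' B := by
  set V := glueWith (boxEdges 4 (2 * H + 1)) (coldExt₁ v) W with hV
  have hδ2 : Real.sqrt (β ^ (2 * ε - 1)) ^ 2 = β ^ (2 * ε - 1) := Real.sq_sqrt (Real.rpow_nonneg hβ.le _)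
  have hcost : ∀ p ∈ plaquettesTouching (boxEdges 4 (2 * H + 1)),
      plaqCostAt ρ p.1 p.2.1.1 p.2.1.2 V ≤ Real.sqrt (β ^ (2 * ε - 1)) ^ 2 := by
    intro p hp
    rw [hδ2]
    exact ((mem_coldGoodSetG_iff ρ β ε V).1 hv p hp).le
  have hout : ∀ e, e ∉ boxEdges 4 (2 * H + 1) → ‖ρ (V e) - 1‖ ≤ r := by
    intro e he
    rw [hV, glueWith_apply_not_mem _ _ _ he, hW e he]
    exact frobDist_expChart_le ρ hρc hinj (hϑ e he)
  have hforest : ∀ x : Site 4, (∀ k : Fin 4, 1 ≤ x k ∧ x k + 1 ≤ 2 * (H : ℤ)) → V (x, 0) = 1 := by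
    intro x hx
    have hmem : (x, (0 : Fin 4)) ∈ boxEdges 4 (2 * H + 1) := by
      rw [mem_boxEdges_iff]
      refine ⟨fun k => ⟨by linarith [(hx k).1], ?_⟩, ?_⟩
      · have := (hx k).2; push_cast; omega
      · have := (hx 0).2; push_cast; omega
    rw [hV, glueWith_apply_mem _ _ _ hmem, coldExt₁, dif_pos ⟨rfl, hx⟩]
  have hlink := frobDist_link_le_of_plaqCost_le_of_exterior_le ρ hρu hH V hr (Real.sqrt_nonneg _) hout hforest hcost e.1.1
  have hVe : V e.1.1 = v e := by
    rw [hV, glueWith_apply_mem _ _ _ e.1.2, coldExt₁, dif_neg e.2]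
  rw [hVe] at hlink
  exact hball _ hlink

/-- **Step 2 (datum).**  For measurable `Ψ ≥ 0`, under the link window `hball` for the chart ball `B = closedBall 0 m`, `m ≤ 1/4`, exterior chart
links `W e = ψ(ϑ_e)`, `‖ϑ_e‖ ≤ r`, and a chart density `g` with `ν|_B = (c·vol|_B)·g`:
`N_W(𝟙_G Ψ) = (c^n · ∫⁻_{B^n} 𝟙_G(chartCfgDE ϑ w) Ψ(chartCfgDE ϑ w) e^{−βS(chartCfgDE ϑ w)} Π_e g(w_e) dw).toReal`. -/
theorem freeIntegral_indicator_eq_lintegral_chart_datum_G (hρc : Continuous ρ) (hinj : Function.Injective ρ)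
    (hρu : ∀ g, ρ g ∈ Matrix.unitaryGroup (Fin N) ℂ) {β ε r m : ℝ} (hβ : 0 < β) (hH : 1 ≤ H) (hr : 0 ≤ r) (hm : m ≤ 1 / 4)
    (hball : ∀ u : G, ‖ρ u - 1‖ ≤ (12 * (H : ℝ) ^ 2 + 2 * H + 1) * (Real.sqrt 2 * Real.sqrt (β ^ (2 * ε - 1)) + 8 * r) →
      u ∈ expChart ρ '' closedBall (0 : EuclideanSpace ℝ (Fin (dimE ρ))) m)
    {W : LGConfig 4 G} {ϑ : Fin (dimE ρ) → (Literature.MathematicalPhysics.QuantumLattice.ZdEdge 4 → ℝ)}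
    (hW : ∀ e, e ∉ boxEdges 4 (2 * H + 1) → W e = expChart ρ (datVec ϑ e))
    (hϑ : ∀ e, e ∉ boxEdges 4 (2 * H + 1) → ‖datVec ϑ e‖ ≤ r)
    {g : EuclideanSpace ℝ (Fin (dimE ρ)) → ℝ} (hgm : Measurable g) {c : ℝ≥0∞} (hctop : c ≠ ∞)
    (hdens : (chartMeasureE ρ (1 / 4)).restrict (closedBall 0 m) =
      (c • (volume : Measure (EuclideanSpace ℝ (Fin (dimE ρ)))).restrict (closedBall 0 m)).withDensity
        (fun a => ENNReal.ofReal (g a)))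
    {Ψ : LGConfig 4 G → ℝ} (hΨm : Measurable Ψ) (hΨ0 : ∀ U, 0 ≤ Ψ U) :
    ∫ v, (coldGoodSetG ρ H β ε).indicator Ψ (glueWith (boxEdges 4 (2 * H + 1)) (coldExt₁ v) W) *
          Real.exp (-β * wilsonBoundaryAction ρ (boxEdges 4 (2 * H + 1)) (glueWith (boxEdges 4 (2 * H + 1)) (coldExt₁ v) W))
        ∂(Measure.pi fun _ : ColdFreeIdx H => haarProbability G) =
      (c ^ Fintype.card (ColdFreeIdx H) *
        ∫⁻ w in Set.pi Set.univ (fun _ => closedBall (0 : EuclideanSpace ℝ (Fin (dimE ρ))) m),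
          ENNReal.ofReal ((coldGoodSetG ρ H β ε).indicator Ψ (chartCfgDE ρ ϑ w) *
            Real.exp (-β * wilsonBoundaryAction ρ (boxEdges 4 (2 * H + 1)) (chartCfgDE ρ ϑ w))) *
          ∏ e, ENNReal.ofReal (g (w e)) ∂(volume : Measure (ColdFreeIdx H → EuclideanSpace ℝ (Fin (dimE ρ))))).toReal := by
  set B : Set (EuclideanSpace ℝ (Fin (dimE ρ))) := closedBall 0 m with hBdef
  have hB4 : B ⊆ closedBall (0 : EuclideanSpace ℝ (Fin (dimE ρ))) (1 / 4) := closedBall_subset_closedBall hm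
  have hSm : Measurable fun U : LGConfig 4 G => Real.exp (-β * wilsonBoundaryAction ρ (boxEdges 4 (2 * H + 1)) U) :=
    (Real.continuous_exp.comp (continuous_const.mul (continuous_wilsonBoundaryAction _ hρc _))).measurable
  have hUm : Measurable fun v : ColdFreeCfg (G := G) H => glueWith (boxEdges 4 (2 * H + 1)) (coldExt₁ v) W :=
    (measurable_glueWith _ _).comp measurable_coldExt₁
  set f : LGConfig 4 G → ℝ := fun U => (coldGoodSetG ρ H β ε).indicator Ψ U *
    Real.exp (-β * wilsonBoundaryAction ρ (boxEdges 4 (2 * H + 1)) U) with hf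
  have hfm : Measurable f := (hΨm.indicator (measurableSet_coldGoodSetG ρ hρc β ε)).mul hSm
  have hf0 : ∀ U, 0 ≤ f U := fun U => mul_nonneg (Set.indicator_nonneg (fun _ _ => hΨ0 _) _) (Real.exp_pos _).le
  -- Bochner → Lebesgue
  rw [show (∫ v, (coldGoodSetG ρ H β ε).indicator Ψ (glueWith (boxEdges 4 (2 * H + 1)) (coldExt₁ v) W) *
      Real.exp (-β * wilsonBoundaryAction ρ (boxEdges 4 (2 * H + 1)) (glueWith (boxEdges 4 (2 * H + 1)) (coldExt₁ v) W))
      ∂(Measure.pi fun _ : ColdFreeIdx H => haarProbability G)) =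
      ∫ v, f (glueWith (boxEdges 4 (2 * H + 1)) (coldExt₁ v) W) ∂(Measure.pi fun _ : ColdFreeIdx H => haarProbability G) from rfl,
    integral_eq_lintegral_of_nonneg_ae (ae_of_all _ fun v => hf0 _) ((hfm.comp hUm).aestronglyMeasurable)]
  congr 1
  -- the integrand vanishes unless every free link is in `ψ(B)`
  have hsupp : (Function.support fun v : ColdFreeCfg (G := G) H =>
      ENNReal.ofReal (f (glueWith (boxEdges 4 (2 * H + 1)) (coldExt₁ v) W))) ⊆ Set.pi Set.univ (fun _ => expChart ρ '' B) := by
    intro v hv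
    rw [Function.mem_support] at hv
    have hmem : glueWith (boxEdges 4 (2 * H + 1)) (coldExt₁ v) W ∈ coldGoodSetG ρ H β ε := by
      by_contra hnot
      exact hv (by simp [hf, Set.indicator_of_notMem hnot])
    exact fun e _ => mem_image_expChart_of_mem_coldGoodSetG_datum ρ hρc hinj hρu hβ hH hr hball hW hϑ v hmem e
  rw [← setLIntegral_eq_of_support_subset hsupp,
    lintegral_pi_image_expChart ρ hρc hinj hB4
      (F := fun v : ColdFreeCfg (G := G) H => ENNReal.ofReal (f (glueWith (boxEdges 4 (2 * H + 1)) (coldExt₁ v) W)))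
      (by exact (ENNReal.measurable_ofReal.comp hfm).comp hUm)]
  -- the chart configuration with datum
  have hcfg : ∀ a : ColdFreeIdx H → EuclideanSpace ℝ (Fin (dimE ρ)),
      glueWith (boxEdges 4 (2 * H + 1)) (coldExt₁ fun i => expChart ρ (a i)) W = chartCfgDE ρ ϑ a :=
    fun a => glueWith_coldExt₁_expChart_datum ρ hρc hinj ϑ hW a
  simp_rw [hcfg]
  -- the density: `(ν|_B)^{⊗n} = (vol|_B)^{⊗n}` with density `Π_e c·g(w_e)`
  lift c to NNReal using hctop
  have hdens' : (chartMeasureE ρ (1 / 4)).restrict B =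
      ((volume : Measure (EuclideanSpace ℝ (Fin (dimE ρ)))).restrict B).withDensity (fun a => (c : ℝ≥0∞) * ENNReal.ofReal (g a)) := by
    rw [hdens, withDensity_smul_measure, ← withDensity_smul' _ _ ENNReal.coe_ne_top]
    rfl
  have hgm' : Measurable fun a : EuclideanSpace ℝ (Fin (dimE ρ)) => (c : ℝ≥0∞) * ENNReal.ofReal (g a) :=
    measurable_const.mul (ENNReal.measurable_ofReal.comp hgm)
  haveI : IsFiniteMeasure ((chartMeasureE ρ (1 / 4)).restrict B) := by
    haveI := isFiniteMeasure_chartMeasureE ρ hρc hinj; infer_instance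
  haveI : SigmaFinite (((volume : Measure (EuclideanSpace ℝ (Fin (dimE ρ)))).restrict B).withDensity
      (fun a => (c : ℝ≥0∞) * ENNReal.ofReal (g a))) := by
    rw [← hdens']; infer_instance
  have hm' : Measurable fun x : ColdFreeIdx H → EuclideanSpace ℝ (Fin (dimE ρ)) => ∏ i, (c : ℝ≥0∞) * ENNReal.ofReal (g (x i)) :=
    Finset.measurable_prod _ fun i _ => hgm'.fun_comp (measurable_pi_apply i)
  have hF' : Measurable fun a : ColdFreeIdx H → EuclideanSpace ℝ (Fin (dimE ρ)) => ENNReal.ofReal (f (chartCfgDE ρ ϑ a)) :=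
    (hfm.fun_comp (measurable_chartCfgDE ρ hρc hinj ϑ)).ennreal_ofReal
  rw [hdens', pi_withDensity _ _ (fun _ => hgm'), ← Measure.restrict_pi_pi, volume_pi,
    lintegral_withDensity_eq_lintegral_mul _ hm' hF']
  have hprod : ∀ w : ColdFreeIdx H → EuclideanSpace ℝ (Fin (dimE ρ)),
      ∏ e, (c : ℝ≥0∞) * ENNReal.ofReal (g (w e)) = (c : ℝ≥0∞) ^ Fintype.card (ColdFreeIdx H) * ∏ e, ENNReal.ofReal (g (w e)) := by
    intro w
    rw [Finset.prod_mul_distrib, Finset.prod_const, Finset.card_univ]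
  have hmeas : Measurable fun w : ColdFreeIdx H → EuclideanSpace ℝ (Fin (dimE ρ)) =>
      ENNReal.ofReal (f (chartCfgDE ρ ϑ w)) * ∏ e, ENNReal.ofReal (g (w e)) :=
    ((ENNReal.measurable_ofReal.comp hfm).comp (measurable_chartCfgDE ρ hρc hinj ϑ)).mul
      (Finset.measurable_prod _ fun e _ => (hgm.fun_comp (measurable_pi_apply e)).ennreal_ofReal)
  rw [← lintegral_const_mul _ hmeas]
  refine lintegral_congr fun w => ?_
  simp only [Pi.mul_apply, hprod, hf]
  ring

/-! ## Step 3 (datum): translation + scaling, the density identity with datum, and the Gaussian reference -/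

/-- **Change of variables with a translation** (`D` colours): for `β > 0` there is `a ∈ (0,∞)` with
`∫⁻ F(w) dw = a · ∫⁻ F(unscaleTE H D β (t + μ')) dt` for every measurable `F ≥ 0` and every fixed `μ'` (constant Jacobian of the scaling,
translation invariance of Lebesgue measure). -/
theorem exists_lintegral_eq_mul_lintegral_unscaleTE_add (D : ℕ) {β : ℝ} (hβ : 0 < β) :
    ∃ a : ℝ≥0∞, a ≠ 0 ∧ a ≠ ∞ ∧ ∀ μ' : TSpaceD H D, ∀ F : (ColdFreeIdx H → EuclideanSpace ℝ (Fin D)) → ℝ≥0∞, Measurable F →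
      ∫⁻ w, F w ∂(volume : Measure (ColdFreeIdx H → EuclideanSpace ℝ (Fin D))) =
        a * ∫⁻ t, F (unscaleTE H D β (t + μ')) ∂(volume : Measure (TSpaceD H D)) := by
  obtain ⟨a, ha0, hatop, ha⟩ := exists_lintegral_eq_mul_lintegral_unscaleTE (H := H) D hβ
  refine ⟨a, ha0, hatop, fun μ' F hF => ?_⟩
  rw [ha F hF]
  congr 1
  exact (lintegral_add_right_eq_self (μ := (volume : Measure (TSpaceD H D))) (fun t => F (unscaleTE H D β t)) μ').symm

/-- **Step 3 (datum).**  For measurable `Ψ ≥ 0` and a density `g > 0`: the chart integral of Step 2 equals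
`a · C · Z^D · ∫⁻ 𝟙_S(t) Ψ(cfgTDE t) e^{tiltWDE t} d(gaussD H D)`, `S = goodTDE ∩ {t | ∀ e, ‖unscaleTE (t + μ') e‖ ≤ m}`, with the Jacobian constant
`a` and the completed-square constant `C` of the datum. -/
theorem lintegral_chartD_eq_const_mul_lintegral_gaussD (hρc : Continuous ρ) (hinj : Function.Injective ρ) {β ε m : ℝ}
    (ϑ : Fin (dimE ρ) → (Literature.MathematicalPhysics.QuantumLattice.ZdEdge 4 → ℝ))
    {g : EuclideanSpace ℝ (Fin (dimE ρ)) → ℝ} (hgm : Measurable g)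
    {Ψ : LGConfig 4 G → ℝ} (hΨm : Measurable Ψ) (hΨ0 : ∀ U, 0 ≤ Ψ U)
    {a : ℝ≥0∞} (ha : ∀ F : (ColdFreeIdx H → EuclideanSpace ℝ (Fin (dimE ρ))) → ℝ≥0∞, Measurable F →
      ∫⁻ w, F w ∂(volume : Measure (ColdFreeIdx H → EuclideanSpace ℝ (Fin (dimE ρ)))) =
        a * ∫⁻ t, F (unscaleTE H (dimE ρ) β (t + meanTE H (dimE ρ) β ϑ)) ∂(volume : Measure (TSpaceD H (dimE ρ))))
    {C : ℝ≥0∞} (hC : ∀ t : TSpaceD H (dimE ρ),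
      ENNReal.ofReal (Real.exp (-β * wilsonBoundaryAction ρ (boxEdges 4 (2 * H + 1)) (cfgTDE ρ H β ϑ t))) *
          ∏ e : ColdFreeIdx H, ENNReal.ofReal (g (unscaleTE H (dimE ρ) β (t + meanTE H (dimE ρ) β ϑ) e)) =
        C * (∏ i, gaussWeight (Qmat (fun e => e ∉ dirFreeEdges H) dirCorner (2 * H + 3)) (t i)) *
          ENNReal.ofReal (Real.exp (tiltWDE ρ H g β ϑ t))) :
    ∫⁻ w in Set.pi Set.univ (fun _ => closedBall (0 : EuclideanSpace ℝ (Fin (dimE ρ))) m),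
          ENNReal.ofReal ((coldGoodSetG ρ H β ε).indicator Ψ (chartCfgDE ρ ϑ w) *
            Real.exp (-β * wilsonBoundaryAction ρ (boxEdges 4 (2 * H + 1)) (chartCfgDE ρ ϑ w))) *
          ∏ e, ENNReal.ofReal (g (w e)) ∂(volume : Measure (ColdFreeIdx H → EuclideanSpace ℝ (Fin (dimE ρ)))) =
      a * C * gaussZ (Qmat (fun e => e ∉ dirFreeEdges H) dirCorner (2 * H + 3)) ^ dimE ρ *
        ∫⁻ t, ENNReal.ofReal ((goodTDE ρ H β ε ϑ ∩
            {t | ∀ e, ‖unscaleTE H (dimE ρ) β (t + meanTE H (dimE ρ) β ϑ) e‖ ≤ m}).indicator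
          (fun t => Ψ (cfgTDE ρ H β ϑ t) * Real.exp (tiltWDE ρ H g β ϑ t)) t) ∂(gaussD H (dimE ρ)) := by
  set B : Set (EuclideanSpace ℝ (Fin (dimE ρ))) := closedBall 0 m with hBdef
  set S := goodTDE ρ H β ε ϑ ∩ {t | ∀ e, ‖unscaleTE H (dimE ρ) β (t + meanTE H (dimE ρ) β ϑ) e‖ ≤ m} with hS
  have hBm : MeasurableSet (Set.pi Set.univ (fun _ : ColdFreeIdx H => B)) :=
    MeasurableSet.univ_pi fun _ => isClosed_closedBall.measurableSet
  have hSm : Measurable fun U : LGConfig 4 G => Real.exp (-β * wilsonBoundaryAction ρ (boxEdges 4 (2 * H + 1)) U) :=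
    (Real.continuous_exp.comp (continuous_const.mul (continuous_wilsonBoundaryAction _ hρc _))).measurable
  have hind : Measurable fun U : LGConfig 4 G => (coldGoodSetG ρ H β ε).indicator Ψ U :=
    hΨm.indicator (measurableSet_coldGoodSetG ρ hρc β ε)
  have hdm : Measurable fun w : ColdFreeIdx H → EuclideanSpace ℝ (Fin (dimE ρ)) => ∏ e, ENNReal.ofReal (g (w e)) :=
    Finset.measurable_prod _ fun e _ => (hgm.fun_comp (measurable_pi_apply e)).ennreal_ofReal
  set F : (ColdFreeIdx H → EuclideanSpace ℝ (Fin (dimE ρ))) → ℝ≥0∞ := fun w =>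
    ENNReal.ofReal ((coldGoodSetG ρ H β ε).indicator Ψ (chartCfgDE ρ ϑ w) *
      Real.exp (-β * wilsonBoundaryAction ρ (boxEdges 4 (2 * H + 1)) (chartCfgDE ρ ϑ w))) * ∏ e, ENNReal.ofReal (g (w e)) with hF
  have hFm : Measurable F :=
    (ENNReal.measurable_ofReal.comp ((hind.comp (measurable_chartCfgDE ρ hρc hinj ϑ)).mul
      (hSm.comp (measurable_chartCfgDE ρ hρc hinj ϑ)))).mul hdm
  rw [← lintegral_indicator hBm, ha _ (hFm.indicator hBm)]
  -- pointwise identity in `t`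
  have hpt : ∀ t : TSpaceD H (dimE ρ),
      (Set.pi Set.univ (fun _ : ColdFreeIdx H => B)).indicator F (unscaleTE H (dimE ρ) β (t + meanTE H (dimE ρ) β ϑ)) =
      C * (ENNReal.ofReal (S.indicator (fun t => Ψ (cfgTDE ρ H β ϑ t) * Real.exp (tiltWDE ρ H g β ϑ t)) t) *
        ∏ i, gaussWeight (Qmat (fun e => e ∉ dirFreeEdges H) dirCorner (2 * H + 3)) (t i)) := by
    intro t
    by_cases hw : unscaleTE H (dimE ρ) β (t + meanTE H (dimE ρ) β ϑ) ∈ Set.pi Set.univ (fun _ : ColdFreeIdx H => B)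
    · rw [Set.indicator_of_mem hw]
      have hw' : ∀ e, ‖unscaleTE H (dimE ρ) β (t + meanTE H (dimE ρ) β ϑ) e‖ ≤ m := fun e =>
        mem_closedBall_zero_iff.1 (hw e (Set.mem_univ _))
      have hcfg : chartCfgDE ρ ϑ (unscaleTE H (dimE ρ) β (t + meanTE H (dimE ρ) β ϑ)) = cfgTDE ρ H β ϑ t := rfl
      rw [hF]; dsimp only
      rw [hcfg, ENNReal.ofReal_mul (Set.indicator_nonneg (fun _ _ => hΨ0 _) _), mul_assoc, hC t]
      by_cases ht : t ∈ goodTDE ρ H β ε ϑ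
      · have hU : cfgTDE ρ H β ϑ t ∈ coldGoodSetG ρ H β ε := ht
        have htS : t ∈ S := ⟨ht, hw'⟩
        rw [Set.indicator_of_mem hU, Set.indicator_of_mem htS, ENNReal.ofReal_mul (hΨ0 _)]
        ring
      · have hU : cfgTDE ρ H β ϑ t ∉ coldGoodSetG ρ H β ε := ht
        have htS : t ∉ S := fun h => ht h.1
        rw [Set.indicator_of_notMem hU, Set.indicator_of_notMem htS]
        simp
    · rw [Set.indicator_of_notMem hw]
      have htS : t ∉ S := fun h => hw (fun e _ => mem_closedBall_zero_iff.2 (h.2 e))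
      rw [Set.indicator_of_notMem htS]
      simp
  simp_rw [hpt]
  have hSmeas : MeasurableSet S :=
    (measurableSet_goodTDE ρ hρc hinj β ε ϑ).inter (measurableSet_ball_unscaleTE_add (dimE ρ) β m _)
  have hg2 : Measurable fun t : TSpaceD H (dimE ρ) =>
      ENNReal.ofReal (S.indicator (fun t => Ψ (cfgTDE ρ H β ϑ t) * Real.exp (tiltWDE ρ H g β ϑ t)) t) :=
    ENNReal.measurable_ofReal.comp ((((hΨm.comp (measurable_cfgTDE ρ hρc hinj β ϑ)).mul
      (Real.measurable_exp.comp (measurable_tiltWDE ρ hρc hinj hgm β ϑ))).indicator hSmeas))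
  have hm2 : Measurable fun t : TSpaceD H (dimE ρ) =>
      ENNReal.ofReal (S.indicator (fun t => Ψ (cfgTDE ρ H β ϑ t) * Real.exp (tiltWDE ρ H g β ϑ t)) t) *
        ∏ i, gaussWeight (Qmat (fun e => e ∉ dirFreeEdges H) dirCorner (2 * H + 3)) (t i) :=
    hg2.mul (Finset.measurable_prod _ fun i _ => (measurable_gaussWeight _).comp (measurable_pi_apply i))
  rw [lintegral_const_mul _ hm2, lintegral_mul_prod_gaussWeight_eq_D (dimE ρ) _ hg2]
  ring

end Box

end Summit.QuantumFields.YangMills.Theorems.ColdBoxAllGroups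

end
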